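import Literature.NumberTheory.Rogawski1990.LocalNormFibreSecondClassSaturation
import Literature.NumberTheory.Rogawski1990.LocalEndoscopicCompactModCentralizerCM
import Literature.NumberTheory.Rogawski1990.LocalTransferFundamentalLemma
import Literature.NumberTheory.Automorphic.OrbitalIntegralCompactFactorCanonical
import Literature.NumberTheory.Automorphic.CompactGroupOrbitalIntegralCanonical
import Literature.NumberTheory.Automorphic.StableCentralizerEquivCM
import Literature.MeasureTheory.Group.OrbitalDescentFunction
import Mathlib.Topology.UrysohnsLemma
import HarnessLib

/-!
# DESCENT AT THE SECOND CLASS ON THE COMPACT DOCK `C′ := Z(ε′)` — the binder `hD′` ((D2ε′)+(sat′)) of ★ `exists_nhds_finsum_side_eq_stableOrbitalIntegralRel_of_compact_dock`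
# (Rogawski 1990, §8.2 Prop. 8.2.1 (a)(d): at the class `ε′` with `G_{ε′} ≅ U(2)ᵃⁿ × E¹` COMPACT, orbital integrals near `ε′` are plain Haar integrals)

Topic `NumberTheory/Rogawski1990`; namespace `Literature.NumberTheory.Rogawski1990`.  **THEOREMS ONLY** (no definition, no named fact, no instance, no notation,
no `sorry`).  Cell `pub/hodgecm-mathlib`, road «N6nsGerm» (crux H413 = stmt-HodgeConjecture-24833), residual stub `stub_N6nsS1pkg` of ED. 1.4 — its first conjunct
`hD′` at the CONCRETE dock `C′ := ↥Z_{G′_v}(ε′)`, `εC := ε′`, `Q′ :=` the bad-frame token; seat A-p17 (g21) (LEAD T8-128), census `CENSUS-hDprime-SecondClassDescent`.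
HONEST LABEL: HC_CM is proved only modulo the printed citations until rung 0 closes; this file is unconditional local harmonic analysis.

THE MATHEMATICS (why the compact side needs no slice, no cut-off NORMALISATION and no quotient in stages).  `v` non-split, `ε_H = (a·1₂, u)`, `u ≠ a`; `P′` a
frame of `H′_v` with Gram blocks `G₁′ ⊕ᶠ G₂′`, `G₁′` ANISOTROPIC, `ε′ P′ = P′(a·1₂ ⊕ᶠ u)`; so `C′ := Z(ε′)` is COMPACT (★ `compactSpace_centralizer_of_frame_of_anisotropic`).
(1) A `Q′`-framed match `g` of a `G`-regular `γ_H` lies in `C′` and is regular in `GL₃`, so its commutant is commutative (★ `commute_of_commute_of_isRegularElt_local`)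
and contains `ε′`: `Z(g) ≤ C′` is compact, hence `Φ_G(c, ψ; m_G) = ∫_{G′_v} ψ(y g y⁻¹) dν_G` (★ `IsCanonical.eq_map_mk_of_compactSpace`: the canonical member at a class
with compact centraliser is `π_* ν_G`).  (2) ★ `exists_isCompact_isOpen_nhds_conj_mem_imp_mem_mul_centralizer` (Harish-Chandra's compactness at `ε′`) gives a compact
open `B₁ ∋ ε′` in `C′` and, for `Ω = tsupport ψ`, a compact `C` with `y t y⁻¹ ∈ Ω, t ∈ B₁ ⇒ y ∈ C·C′` — a COMPACT set; with a compactly supported `β = 1` on `C·C′`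
(Urysohn) the function `ψε(m) := ν′(C′)⁻¹ ∫ β(y) ψ(y m y⁻¹) dν_G` is LOCALLY CONSTANT on all of `C′` (★ `isLocallyConstant_integral_conj`) and equals
`ν′(C′)⁻¹ ∫ ψ(y m y⁻¹) dν_G` on `B₁`.  (3) Shrinking `B₁` to a `C′`-conjugation-invariant neighbourhood `B₂` (compactness of `C′`), for `g ∈ B₂`:
`Φ^{C′}(⟦g⟧, ψε; m′) = ∫_{C′} ψε(k g k⁻¹) dν′(k) = ν′(C′)·ν′(C′)⁻¹ ∫ ψ(y g y⁻¹) dν_G = Φ_G(c, ψ)` (★ `IsCanonical.classOrbitalIntegral_eq_integral_conj_of_mk_eq` on the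
compact group; right invariance of `ν_G`).  (4) ★ `exists_nhds_forall_frameRep_mem_centralizer_nhds` ((sat′)) puts the framed match of every `γ_H` near `ε_H` inside
`B′ ∩ B₂`.

* §1 **`compactSpace_centralizer_of_commute_of_isRegularElt`**, §2 **`IsCanonical.classOrbitalIntegral_eq_integral_conj_of_compactSpace_centralizer`** (generic),
  §3 **`exists_isLocallyConstant_descent_secondClass`** = `hD′` at `C′ := ↥Z(ε′)`.

## References
* [Rogawski1990] J. D. Rogawski, *Automorphic Representations of Unitary Groups in Three Variables*, Ann. of Math. Stud. 123 (1990), §8.2 Prop. 8.2.1 (a)(d) pp. 112–122;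
  §4.3 (4.3.1) p. 43; §3.8 Prop. 3.8.1 (a) p. 27.
* [HarishChandra1970] Harish-Chandra (van Dijk), *Harmonic Analysis on Reductive p-adic Groups*, LNM 162 (1970), Part I §3 Lemmas 19–21.
* [DeitmarEchterhoff2014] A. Deitmar, S. Echterhoff, *Principles of Harmonic Analysis*, 2nd ed. (2014), Cor. 1.5.4, Thm. 1.5.3.
-/

set_option autoImplicit false

noncomputable section

open NumberField IsDedekindDomain Matrix Topology Set Filter MeasureTheory MeasureTheory.Measure
open scoped MatrixGroups Pointwise

namespace Literature.NumberTheory.Rogawski1990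

open Literature.NumberTheory.Automorphic Literature.NumberTheory.Automorphic.UnitaryGroup Literature.NumberTheory.GaloisRepresentations
open Literature.MeasureTheory.Group
open Literature.AlgebraicGeometry.ShimuraVarieties (unitaryGroup)

/-! ## §1 The centraliser of a regular element commuting with `ε′` is compact when `Z(ε′)` is -/

section RegularCompact

variable (L : Type) [Field L] [NumberField L] [IsCMField L] (v : HeightOneSpectrum (𝓞 ↥(maximalRealSubfield L))) {N : ℕ}
  (H : Matrix (Fin N) (Fin N) L)

/-- **`Z(g)` IS COMPACT for a `GL_N`-regular `g ∈ G′_v` commuting with an `ε′` whose centraliser is compact**: the commutant of a regular element is commutative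
(★ `commute_of_commute_of_isRegularElt_local`) and contains `ε′`, so `Z(g) ≤ Z(ε′)`, closed in a compact. [cite: Rogawski1990, §8.2 Prop. 8.2.1 (a) p. 112; §4.3 p. 43] -/
theorem compactSpace_centralizer_of_commute_of_isRegularElt {ε' g : (UnitaryGroup.cmDatum L N H).Local v}
    [hZ : CompactSpace ↥(Subgroup.centralizer ({ε'} : Set ((UnitaryGroup.cmDatum L N H).Local v)))]
    (hg : IsRegularElt (g.val : GL (Fin N) (UnitaryGroup.LocalRing L v))) (hc : g * ε' = ε' * g) :
    CompactSpace ↥(Subgroup.centralizer ({g} : Set ((UnitaryGroup.cmDatum L N H).Local v))) := by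
  have hle : ((Subgroup.centralizer ({g} : Set ((UnitaryGroup.cmDatum L N H).Local v))) : Set ((UnitaryGroup.cmDatum L N H).Local v)) ⊆
      (Subgroup.centralizer ({ε'} : Set ((UnitaryGroup.cmDatum L N H).Local v)) : Set ((UnitaryGroup.cmDatum L N H).Local v)) := by
    intro x hx
    rw [SetLike.mem_coe, Subgroup.mem_centralizer_singleton_iff] at hx ⊢
    have hxg : Commute (x.val.val : Matrix (Fin N) (Fin N) (UnitaryGroup.LocalRing L v)) g.val.val := by
      have h1 : x.val * g.val = g.val * x.val := congrArg Subtype.val hx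
      show x.val.val * g.val.val = g.val.val * x.val.val
      rw [← Units.val_mul, ← Units.val_mul, h1]
    have hεg : Commute (ε'.val.val : Matrix (Fin N) (Fin N) (UnitaryGroup.LocalRing L v)) g.val.val := by
      have h1 : ε'.val * g.val = g.val * ε'.val := congrArg Subtype.val hc.symm
      show ε'.val.val * g.val.val = g.val.val * ε'.val.val
      rw [← Units.val_mul, ← Units.val_mul, h1]
    have hxε : Commute (x.val.val : Matrix (Fin N) (Fin N) (UnitaryGroup.LocalRing L v)) ε'.val.val :=
      commute_of_commute_of_isRegularElt_local L v g hg _ _ hxg hεg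
    exact Subtype.ext (Units.ext hxε.eq)
  exact isCompact_iff_compactSpace.1
    ((isCompact_iff_compactSpace.2 hZ).of_isClosed_subset (isClosed_coe_centralizer_singleton g) hle)

end RegularCompact

/-! ## §2 Generic: the canonical orbital integral at a class with COMPACT centraliser is the plain Haar integral of the conjugated function -/

section CompactCentraliser

variable {G : Type*} [Group G] [TopologicalSpace G] [IsTopologicalGroup G] [LocallyCompactSpace G] [SecondCountableTopology G] [T2Space G]
  [MeasurableSpace G] [BorelSpace G]
  [∀ γ : G, MeasurableSpace (G ⧸ Subgroup.centralizer ({γ} : Set G))] [∀ γ : G, BorelSpace (G ⧸ Subgroup.centralizer ({γ} : Set G))]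
  {E : Type*} [NormedAddCommGroup E] [NormedSpace ℝ E]

/-- **`Φ(c, f; m) = ∫_G f(y g y⁻¹) dν(y)` AT A CLASS WITH COMPACT CENTRALISER** for a canonical family `m` (★ `IsCanonical.eq_map_mk_of_compactSpace`: `m_c = π_* ν`),
`f` continuous and ANY representative `g` of `c` (`ν` right invariant). [cite: DeitmarEchterhoff2014, Cor. 1.5.4] [cite: Rogawski1990, §4.3 (4.3.1) p. 43] -/
theorem IsCanonical.classOrbitalIntegral_eq_integral_conj_of_compactSpace_centralizer
    {P : G → Prop} {ν : Measure G} [ν.IsHaarMeasure] [ν.IsMulRightInvariant] {m : OrbitalMeasureFamily G} (hm : m.IsCanonical P ν)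
    {c : ConjClasses G} (hc : P (Quotient.out c)) [CompactSpace ↥(Subgroup.centralizer ({(Quotient.out c : G)} : Set G))]
    (f : G → E) (hf : Continuous f) (g : G) (hg : ConjClasses.mk g = c) :
    classOrbitalIntegral m f c = ∫ y, f (y * g * y⁻¹) ∂ν := by
  rw [classOrbitalIntegral_eq, hm.eq_map_mk_of_compactSpace c hc, orbitalIntegral_eq_integral_descConj]
  have hcont : Continuous (descConj (Quotient.out c) (Subgroup.centralizer ({(Quotient.out c : G)} : Set G))
      (fun _ hg => Subgroup.mem_centralizer_singleton_iff.1 hg) f) := by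
    rw [(QuotientGroup.isQuotientMap_mk (Subgroup.centralizer ({(Quotient.out c : G)} : Set G))).continuous_iff, descConj_comp_mk]
    exact hf.comp ((continuous_id.mul continuous_const).mul continuous_id.inv)
  rw [integral_map (φ := (QuotientGroup.mk : G → G ⧸ Subgroup.centralizer ({(Quotient.out c : G)} : Set G)))
    (QuotientGroup.continuous_mk.measurable.aemeasurable) hcont.aestronglyMeasurable]
  simp only [descConj_mk]
  -- `out c = x g x⁻¹`; right invariance
  obtain ⟨x, hx⟩ := isConj_iff.1 (ConjClasses.mk_eq_mk_iff_isConj.1 (hg.trans (Quotient.out_eq c).symm))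
  rw [← hx]
  have h3 : ∀ y : G, y * (x * g * x⁻¹) * y⁻¹ = (y * x) * g * (y * x)⁻¹ := fun y => by group
  simp_rw [h3]
  exact integral_mul_right_eq_self (fun y => f (y * g * y⁻¹)) x

end CompactCentraliser

/-! ## §3 `hD′` at the concrete dock `C′ := Z(ε′)` -/

section SecondClass

variable (L : Type) [Field L] [NumberField L] [IsCMField L] (H' : Matrix (Fin 3) (Fin 3) L) (v : HeightOneSpectrum (𝓞 ↥(maximalRealSubfield L)))

variable [MeasurableSpace ((UnitaryGroup.cmDatum L 3 H').Local v)] [BorelSpace ((UnitaryGroup.cmDatum L 3 H').Local v)]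
  [iG : ∀ γ : ((UnitaryGroup.cmDatum L 3 H').Local v), MeasurableSpace (((UnitaryGroup.cmDatum L 3 H').Local v) ⧸ Subgroup.centralizer ({γ} : Set ((UnitaryGroup.cmDatum L 3 H').Local v)))]
  [bG : ∀ γ : ((UnitaryGroup.cmDatum L 3 H').Local v), BorelSpace (((UnitaryGroup.cmDatum L 3 H').Local v) ⧸ Subgroup.centralizer ({γ} : Set ((UnitaryGroup.cmDatum L 3 H').Local v)))]

/-- **DESCENT AT THE SECOND CLASS ON THE COMPACT DOCK** — the binder `hD′` of ★ `exists_nhds_finsum_side_eq_stableOrbitalIntegralRel_of_compact_dock` at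
`C′ := ↥Z(ε′)`, `εC := ε′`, `Q′ γ_H g :↔ ∃ B, g P′ = P′ (B ⊕ᶠ γ_{H,2})`.  See the module docstring for the four steps.
[cite: Rogawski1990, §8.2 Prop. 8.2.1 (a)(d) pp. 112–122; §4.3 (4.3.1) p. 43] [cite: HarishChandra1970, Part I §3 Lemmas 19–21] [cite: DeitmarEchterhoff2014, Cor. 1.5.4] -/
theorem exists_isLocallyConstant_descent_secondClass
    (hH' : (H'.map (cmConjRingHom L))ᵀ = H') (hdet' : H'.det ≠ 0)
    (w : UnitaryGroup.PlacesOver L v) (hw : IsCMField.complexConj L • w.1 = w.1)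
    (νG : Measure ((UnitaryGroup.cmDatum L 3 H').Local v)) [νG.IsHaarMeasure] [νG.IsMulRightInvariant]
    {mG : OrbitalMeasureFamily ((UnitaryGroup.cmDatum L 3 H').Local v)}
    (hmG : mG.IsCanonical (fun γ => IsRegularElt (γ.val : GL (Fin 3) (UnitaryGroup.LocalRing L v))) νG)
    (εH : (UnitaryGroup.cmDatum L 2 (Matrix.of fun i j : Fin 2 => if i.val + j.val + 1 = 2 then (1 : L) else 0)).Local v ×
      (UnitaryGroup.cmDatum L 1 (Matrix.of fun i j : Fin 1 => if i.val + j.val + 1 = 1 then (1 : L) else 0)).Local v) (a : UnitaryGroup.LocalRing L v)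
    (ha : (εH.1.val.val : Matrix (Fin 2) (Fin 2) (UnitaryGroup.LocalRing L v)) = a • (1 : Matrix (Fin 2) (Fin 2) (UnitaryGroup.LocalRing L v)))
    (hu : (εH.2.val.val : Matrix (Fin 1) (Fin 1) (UnitaryGroup.LocalRing L v)) 0 0 ≠ a)
    {P' : GL (Fin 3) (UnitaryGroup.LocalRing L v)} {G₁' : Matrix (Fin 2) (Fin 2) (UnitaryGroup.LocalRing L v)} {G₂' : Matrix (Fin 1) (Fin 1) (UnitaryGroup.LocalRing L v)}
    (hP' : twistGram (UnitaryGroup.conjLocal L (IsCMField.complexConj L) v) ((UnitaryGroup.adelicForm L 3 H').map (UnitaryGroup.adeleToLocal L v)) P'.val =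
      finSum 2 1 G₁' G₂')
    (hanis' : ∀ x : Fin 2 → UnitaryGroup.LocalRing L v, hermForm (UnitaryGroup.conjLocal L (IsCMField.complexConj L) v) G₁' x x = 0 → x = 0)
    (ε' : (UnitaryGroup.cmDatum L 3 H').Local v)
    (hε' : (ε'.val.val : Matrix (Fin 3) (Fin 3) (UnitaryGroup.LocalRing L v)) * P'.val =
      P'.val * finSum 2 1 (a • (1 : Matrix (Fin 2) (Fin 2) (UnitaryGroup.LocalRing L v))) (εH.2.val.val : Matrix (Fin 1) (Fin 1) (UnitaryGroup.LocalRing L v)))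
    -- the `C′`-side data at `C′ := Z(ε′)`
    [MeasurableSpace ↥(Subgroup.centralizer ({ε'} : Set ((UnitaryGroup.cmDatum L 3 H').Local v)))]
    [BorelSpace ↥(Subgroup.centralizer ({ε'} : Set ((UnitaryGroup.cmDatum L 3 H').Local v)))]
    [LocallyCompactSpace ↥(Subgroup.centralizer ({ε'} : Set ((UnitaryGroup.cmDatum L 3 H').Local v)))]
    [∀ m : ↥(Subgroup.centralizer ({ε'} : Set ((UnitaryGroup.cmDatum L 3 H').Local v))),
      MeasurableSpace (↥(Subgroup.centralizer ({ε'} : Set ((UnitaryGroup.cmDatum L 3 H').Local v))) ⧸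
        Subgroup.centralizer ({m} : Set ↥(Subgroup.centralizer ({ε'} : Set ((UnitaryGroup.cmDatum L 3 H').Local v)))))]
    [∀ m : ↥(Subgroup.centralizer ({ε'} : Set ((UnitaryGroup.cmDatum L 3 H').Local v))),
      BorelSpace (↥(Subgroup.centralizer ({ε'} : Set ((UnitaryGroup.cmDatum L 3 H').Local v))) ⧸
        Subgroup.centralizer ({m} : Set ↥(Subgroup.centralizer ({ε'} : Set ((UnitaryGroup.cmDatum L 3 H').Local v)))))]
    (ν' : Measure ↥(Subgroup.centralizer ({ε'} : Set ((UnitaryGroup.cmDatum L 3 H').Local v)))) [ν'.IsHaarMeasure] [ν'.IsMulRightInvariant]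
    (P'' : ↥(Subgroup.centralizer ({ε'} : Set ((UnitaryGroup.cmDatum L 3 H').Local v))) → Prop)
    (hP'' : ∀ m : ↥(Subgroup.centralizer ({ε'} : Set ((UnitaryGroup.cmDatum L 3 H').Local v))),
      IsRegularElt ((m.1.val : GL (Fin 3) (UnitaryGroup.LocalRing L v))) → P'' m)
    {m' : OrbitalMeasureFamily ↥(Subgroup.centralizer ({ε'} : Set ((UnitaryGroup.cmDatum L 3 H').Local v)))} (hm' : m'.IsCanonical P'' ν') :
    ∀ ψ : ((UnitaryGroup.cmDatum L 3 H').Local v) → ℂ, IsLocSmooth ψ →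
      ∃ ψε : ↥(Subgroup.centralizer ({ε'} : Set ((UnitaryGroup.cmDatum L 3 H').Local v))) → ℂ, IsLocallyConstant ψε ∧
        ∀ B' ∈ 𝓝 (⟨ε', Subgroup.mem_centralizer_singleton_iff.2 rfl⟩ : ↥(Subgroup.centralizer ({ε'} : Set ((UnitaryGroup.cmDatum L 3 H').Local v)))),
          ∃ V ∈ 𝓝 εH, ∀ γH ∈ V, IsLocalGRegular L v γH →
            ∀ c : ConjClasses ((UnitaryGroup.cmDatum L 3 H').Local v),
              (∃ x : ((UnitaryGroup.cmDatum L 3 H').Local v), (∃ B : Matrix (Fin 2) (Fin 2) (UnitaryGroup.LocalRing L v),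
                ((x * Quotient.out c * x⁻¹).val.val : Matrix (Fin 3) (Fin 3) (UnitaryGroup.LocalRing L v)) * P'.val =
                  P'.val * finSum 2 1 B (γH.2.val.val : Matrix (Fin 1) (Fin 1) (UnitaryGroup.LocalRing L v)))) →
              IsLocalNormPair L H' v γH (Quotient.out c) →
                ∃ m ∈ B', P'' (Quotient.out (ConjClasses.mk m)) ∧ classOrbitalIntegral mG ψ c = classOrbitalIntegral m' ψε (ConjClasses.mk m) := by
  classical
  intro ψ hψ
  haveI : Algebra.IsQuadraticExtension ↥(maximalRealSubfield L) L := IsCMField.isQuadraticExtension L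
  have hv : Subsingleton (UnitaryGroup.PlacesOver L v) :=
    UnitaryGroup.PlacesOver.subsingleton_of_smul_eq (IsCMField.complexConj L) (IsCMField.complexConj_ne_one L) w hw
  set σ := UnitaryGroup.conjLocal L (IsCMField.complexConj L) v with hσdef
  set Hv := (UnitaryGroup.adelicForm L 3 H').map (UnitaryGroup.adeleToLocal L v) with hHvdef
  set εC : ↥(Subgroup.centralizer ({ε'} : Set ((UnitaryGroup.cmDatum L 3 H').Local v))) := ⟨ε', Subgroup.mem_centralizer_singleton_iff.2 rfl⟩ with hεCdef
  set u : UnitaryGroup.LocalRing L v := (εH.2.val.val : Matrix (Fin 1) (Fin 1) (UnitaryGroup.LocalRing L v)) 0 0 with hudef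
  have hHvd : IsUnit Hv.det := isUnit_det_localForm L 3 H' v hdet'
  have hU1 : (εH.2.val.val : Matrix (Fin 1) (Fin 1) (UnitaryGroup.LocalRing L v)) = u • (1 : Matrix (Fin 1) (Fin 1) _) := by
    ext i k; fin_cases i; fin_cases k; simp [hudef]
  have hε'D : (ε'.val.val : Matrix (Fin 3) (Fin 3) (UnitaryGroup.LocalRing L v)) * P'.val =
      P'.val * finSum 2 1 (a • (1 : Matrix (Fin 2) (Fin 2) (UnitaryGroup.LocalRing L v))) (u • (1 : Matrix (Fin 1) (Fin 1) (UnitaryGroup.LocalRing L v))) := by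
    rw [← hU1]; exact hε'
  have hau : IsUnit (a - u) := isUnit_localRing_of_ne_zero_of_subsingleton L v hv (sub_ne_zero.2 (Ne.symm hu))
  have hu1 : u * σ u = 1 := by rw [mul_comm]; exact conjLocal_finGammaTwo_mul_finGammaTwo L v εH
  -- `C′ = Z(ε′)` is compact
  have hd' : G₁'.det * G₂' 0 0 = σ P'.val.det * Hv.det * P'.val.det := by
    rw [← Matrix.det_fin_one G₂', ← det_finSum, ← hP', det_twistGram]
  have hG₂'u : IsUnit (G₂' 0 0) := by
    refine isUnit_of_mul_isUnit_right (?_ : IsUnit (G₁'.det * G₂' 0 0))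
    rw [hd']
    exact (((Matrix.isUnits_det_units P').map σ).mul hHvd).mul (Matrix.isUnits_det_units P')
  haveI hZc : CompactSpace ↥(Subgroup.centralizer ({ε'} : Set ((UnitaryGroup.cmDatum L 3 H').Local v))) := compactSpace_centralizer_of_frame_of_anisotropic L v H' ε' w hw hau hε'D hP' hanis' hG₂'u
  -- (2) Harish-Chandra's compactness at `ε′` (★ A-p16) and the cut-off
  obtain ⟨B₁, -, hB₁o, hεB₁, hwin⟩ := exists_isCompact_isOpen_nhds_conj_mem_imp_mem_mul_centralizer L (N₁ := 2) H' hH' (isUnit_iff_ne_zero.2 hdet') w hw ε' P'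
    (Ne.symm hu) hu1 hε'D
  obtain ⟨C, hCc, hC⟩ := hwin (tsupport ψ) hψ.2
  have hS₀ : IsCompact (C * ((Subgroup.centralizer ({ε'} : Set ((UnitaryGroup.cmDatum L 3 H').Local v))) : Set ((UnitaryGroup.cmDatum L 3 H').Local v))) := hCc.mul (isCompact_iff_compactSpace.2 hZc)
  obtain ⟨β, hβ1, -, hβc, -⟩ := exists_continuous_one_zero_of_isCompact hS₀ isClosed_empty (Set.disjoint_empty _)
  set I : ↥(Subgroup.centralizer ({ε'} : Set ((UnitaryGroup.cmDatum L 3 H').Local v))) → ℂ := fun m => ∫ y, (β y) • ψ (y * (m : (UnitaryGroup.cmDatum L 3 H').Local v) * y⁻¹) ∂νG with hIdef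
  have hIloc : IsLocallyConstant I := isLocallyConstant_integral_conj νG (Subgroup.centralizer ({ε'} : Set ((UnitaryGroup.cmDatum L 3 H').Local v))) hβc hψ.1
  have hIB₁ : ∀ t ∈ B₁, I t = ∫ y, ψ (y * (t : (UnitaryGroup.cmDatum L 3 H').Local v) * y⁻¹) ∂νG := by
    intro t ht
    refine congrArg (integral νG) (funext fun y => ?_)
    by_cases hψy : ψ (y * (t : (UnitaryGroup.cmDatum L 3 H').Local v) * y⁻¹) = 0
    · rw [hψy, smul_zero]
    · have hy : y ∈ C * ((Subgroup.centralizer ({ε'} : Set ((UnitaryGroup.cmDatum L 3 H').Local v))) : Set ((UnitaryGroup.cmDatum L 3 H').Local v)) := hC y t ht (subset_tsupport _ (Function.mem_support.2 hψy))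
      rw [show β y = 1 from hβ1 hy, one_smul]
  set cst : ℂ := (((ν'.real Set.univ)⁻¹ : ℝ) : ℂ) with hcst
  refine ⟨fun m => cst * I m, hIloc.comp fun z => cst * z, ?_⟩
  intro B' hB'
  -- (3) a `C′`-conjugation-invariant shrinking of `B₁`
  have hB₁n : B₁ ∈ 𝓝 εC := hB₁o.mem_nhds hεB₁
  have hB₂ : ∀ᶠ m in 𝓝 εC, ∀ k ∈ (Set.univ : Set ↥(Subgroup.centralizer ({ε'} : Set ((UnitaryGroup.cmDatum L 3 H').Local v)))), k * m * k⁻¹ ∈ B₁ := by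
    apply isCompact_univ.eventually_forall_of_forall_eventually
    intro k _
    have hcont : Continuous fun z : ↥(Subgroup.centralizer ({ε'} : Set ((UnitaryGroup.cmDatum L 3 H').Local v))) × ↥(Subgroup.centralizer ({ε'} : Set ((UnitaryGroup.cmDatum L 3 H').Local v))) => z.2 * z.1 * z.2⁻¹ :=
      (continuous_snd.mul continuous_fst).mul continuous_snd.inv
    have hkε : k * εC * k⁻¹ = εC := by
      rw [mul_inv_eq_iff_eq_mul]
      have h1 : (k : (UnitaryGroup.cmDatum L 3 H').Local v) * ε' = ε' * k := Subgroup.mem_centralizer_singleton_iff.1 k.2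
      exact Subtype.ext h1
    have hmem : (fun z : ↥(Subgroup.centralizer ({ε'} : Set ((UnitaryGroup.cmDatum L 3 H').Local v))) × ↥(Subgroup.centralizer ({ε'} : Set ((UnitaryGroup.cmDatum L 3 H').Local v))) => z.2 * z.1 * z.2⁻¹) ⁻¹' B₁ ∈ 𝓝 (εC, k) :=
      hcont.continuousAt.preimage_mem_nhds (by show B₁ ∈ 𝓝 (k * εC * k⁻¹); rw [hkε]; exact hB₁n)
    exact hmem
  obtain ⟨V, hV, hVS⟩ := exists_nhds_forall_frameRep_mem_centralizer_nhds L v H' w hw hHvd εH a ha hu hP' hanis' ε' hε' _ (inter_mem hB' hB₂)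
  refine ⟨V, hV, ?_⟩
  rintro γH hγV hreg c ⟨x, B, hxP⟩ hpair
  set g : (UnitaryGroup.cmDatum L 3 H').Local v := x * Quotient.out c * x⁻¹ with hgdef
  have hpair' : IsLocalNormPair L H' v γH g := (isLocalNormPair_conj_right L v H' γH (Quotient.out c) x).2 hpair
  have hgreg : IsRegularElt (g.val : GL (Fin 3) (UnitaryGroup.LocalRing L v)) := isRegularElt_of_isLocalNormPair L H' v hpair' hreg
  obtain ⟨hgZ, hgB⟩ := hVS γH hγV g ⟨B, hxP⟩ hpair'
  set m : ↥(Subgroup.centralizer ({ε'} : Set ((UnitaryGroup.cmDatum L 3 H').Local v))) := ⟨g, hgZ⟩ with hmdef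
  have hmk : ConjClasses.mk g = c := (ConjClasses.mk_eq_mk_iff_isConj.2 (isConj_iff.2 ⟨x, rfl⟩)).symm.trans (Quotient.out_eq c)
  -- `P″` at the class of `m`: a conjugate of the regular `g`
  have hP''m : P'' (Quotient.out (ConjClasses.mk m)) := by
    obtain ⟨k, hk⟩ := isConj_iff.1 (ConjClasses.mk_eq_mk_iff_isConj.1 (Quotient.out_eq (ConjClasses.mk m)).symm)
    apply hP''
    rw [← hk]
    show IsRegularElt ((k.1 * g * k.1⁻¹).val : GL (Fin 3) (UnitaryGroup.LocalRing L v))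
    exact (isRegularElt_conj_iff _ _).2 hgreg
  refine ⟨m, hgB.1, hP''m, ?_⟩
  -- (1) the `G′`-side: compact centraliser, plain Haar integral
  haveI : CompactSpace ↥(Subgroup.centralizer ({g} : Set ((UnitaryGroup.cmDatum L 3 H').Local v))) :=
    compactSpace_centralizer_of_commute_of_isRegularElt L v H' hgreg (Subgroup.mem_centralizer_singleton_iff.1 hgZ)
  have hiso : IsConj g (Quotient.out c) := isConj_iff.2 ⟨x⁻¹, by rw [hgdef]; group⟩
  haveI : CompactSpace ↥(Subgroup.centralizer ({(Quotient.out c : (UnitaryGroup.cmDatum L 3 H').Local v)} : Set ((UnitaryGroup.cmDatum L 3 H').Local v))) :=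
    compactSpace_centralizer_of_isConj hiso
  have hψc : Continuous ψ := hψ.1.continuous
  have hcreg : IsRegularElt ((Quotient.out c).val : GL (Fin 3) (UnitaryGroup.LocalRing L v)) := isRegularElt_of_isLocalNormPair L H' v hpair hreg
  rw [IsCanonical.classOrbitalIntegral_eq_integral_conj_of_compactSpace_centralizer hmG hcreg ψ hψc g hmk]
  -- (3) the `C′`-side: a Haar average of the locally constant `ψε` over the compact `C′`
  have hψεc : Continuous fun n : ↥(Subgroup.centralizer ({ε'} : Set ((UnitaryGroup.cmDatum L 3 H').Local v))) => cst * I n := (hIloc.comp fun z => cst * z).continuous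
  rw [hm'.classOrbitalIntegral_eq_integral_conj_of_mk_eq ν' hP''m (fun n : ↥(Subgroup.centralizer ({ε'} : Set ((UnitaryGroup.cmDatum L 3 H').Local v))) => cst * I n) hψεc m rfl]
  have hk : ∀ k : ↥(Subgroup.centralizer ({ε'} : Set ((UnitaryGroup.cmDatum L 3 H').Local v))), cst * I (k * m * k⁻¹) = cst * ∫ y, ψ (y * g * y⁻¹) ∂νG := by
    intro k
    have hkm : k * m * k⁻¹ ∈ B₁ := hgB.2 k (Set.mem_univ k)
    rw [hIB₁ _ hkm]
    congr 1
    have hcoe : ((k * m * k⁻¹ : ↥(Subgroup.centralizer ({ε'} : Set ((UnitaryGroup.cmDatum L 3 H').Local v)))) : (UnitaryGroup.cmDatum L 3 H').Local v) = k.1 * g * k.1⁻¹ := rfl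
    rw [hcoe]
    have h3 : ∀ y : (UnitaryGroup.cmDatum L 3 H').Local v, y * (k.1 * g * k.1⁻¹) * y⁻¹ = (y * k.1) * g * (y * k.1)⁻¹ := fun y => by group
    simp_rw [h3]
    exact integral_mul_right_eq_self (fun y => ψ (y * g * y⁻¹)) k.1
  simp_rw [hk]
  rw [integral_const, Complex.real_smul, hcst, Complex.ofReal_inv, mul_inv_cancel_left₀]
  -- `ν′(C′) ≠ 0, ∞`
  rw [Ne, Complex.ofReal_eq_zero, measureReal_def, ENNReal.toReal_eq_zero_iff, not_or]
  exact ⟨isOpen_univ.measure_ne_zero ν' Set.univ_nonempty, measure_ne_top ν' _⟩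

end SecondClass

end Literature.NumberTheory.Rogawski1990
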